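import Mathlib
import Literature.AlgebraicGeometry.Resolution.CobordantGame
import Literature.AlgebraicGeometry.Resolution.CobordantVertexChart
import Literature.AlgebraicGeometry.Resolution.PlaneGermBlowup
import Literature.AlgebraicGeometry.Resolution.PlaneGermNonNCCountRadical
import Summits.ResolutionOfSingularities.ResolutionOfSingularities.Theorems.WeightedInvariantLocalWeightedDropPlaneCountRadical
import Summits.ResolutionOfSingularities.ResolutionOfSingularities.Theorems.WeightedInvariantLocalWeightedDropCoeffTransportPoint
import Summits.ResolutionOfSingularities.ResolutionOfSingularities.Theorems.WeightedInvariantLocalWeightedDropSeparablePointStep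

/-!
# `WeightedInvariant.LocalWeightedDrop`, line `hasse-ridge-face-selection`: REDUCTION OF THE SEPARABLE char-2 DOUBLE POINTS TO A
# NORMAL-CROSSING LINEAR COEFFICIENT (`A₁ = x₀^a x₁^b · unit` in formal coordinates)

Crux item stmt-ResolutionOfSingularities-8899 `LocalWeightedDrop` (route `ResolutionOfSingularities/WeightedInvariant`), serving the
door `WeightedConstruction` stmt-ResolutionOfSingularities-0571.  [OURS · L1 W4.3, chain w43, stub worker 2 (gen 2): second unit of the
reduction piece S2sM `stub_charTwoSeparableReductionWon` (typed sub-cut of S2s, evidence #56 on stmt-8899); NOT a statement of any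
manuscript.]

`sepWon_of_ncWon` (characteristic `2`, `k = k̄`; only the singular one-variable germs assumed won): IF every position
`y² + A₁ y + A₀` (`ord A₀ ≥ 3`, `ord A₁ ≥ 2`, `A₁ ≠ 0`) whose linear coefficient has NORMAL-CROSSING SUPPORT (`PlaneGerm.IsNC A₁`:
`A₁ ∘ Φ = u · x₀^a x₁^c` for a formal coordinate change `Φ` of the `x`-plane and a unit `u`) is won, THEN every separable position is won.
Proof: induction on the non-normal-crossing count `ν(A₁)` of the plane curve `A₁ = 0` (`PlaneGermNonNCCountRad`, proved in the tree for
every field: `stub_planeCountRadical`) through the point step with cleaning `SepPointStep.won_dp1_of_pointStep`: at an exceptional point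
`c` the count drops at some live slot `i₀` on the reduced total transform `D = s · G|` (`A₁ ∘ chart(c) = s^a G`, `s ∤ G`), and the
transported linear coefficient `(s B₁)| = s^{a-2} · D` divides `D^{a-1}`, so its count is `≤ ν(D) < ν(A₁)` by radical monotonicity;
`(s B₁)| ≠ 0` (`CoeffTransport.slice_X_mul_eq_zero_iff`).  The residual class — separable double points with monomial `A₁` — is where
the characteristic-2 content of S2sM (Hauser–Perlega 2024 §§8–9 with boundary `⊇ {A₁ = 0}`) lives; `charTwoSeparableReduction_of_ncWon`
states the reduction in the stub's quantifier shape.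
-/

set_option linter.dupNamespace false -- mandated namespace of this single-conjunct summit

namespace Summit.ResolutionOfSingularities.ResolutionOfSingularities.Theorems

open Literature.AlgebraicGeometry.Resolution
open Literature.AlgebraicGeometry.Resolution.CobordantGame

namespace SepNCReduction

open MvPowerSeries

variable {k : Type} [Field k]

/-- REDUCTION TO NORMAL-CROSSING `A₁` (characteristic `2`, `k = k̄`; only the singular one-variable germs assumed won): if every
separable position `y² + A₁ y + A₀` with `PlaneGerm.IsNC A₁` is won, then every separable position is won — induction on the
non-normal-crossing count of the plane curve `A₁ = 0` through the point step with cleaning. -/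
theorem sepWon_of_ncWon [CharP k 2] [IsAlgClosed k]
    (hlow : ∀ g : MvPowerSeries (Fin 1) k, CobordantGame.IsSingular k g → CobordantGame.Won k 1 g)
    (hNC : ∀ A₀ A₁ : MvPowerSeries (Fin 2) k, (2 : ℕ∞) < A₀.order → (1 : ℕ∞) < A₁.order → A₁ ≠ 0 → PlaneGerm.IsNC A₁ →
      CobordantGame.Won k 3 (X (Fin.last 2) ^ 2 + (rename (Fin.succAboveEmb (Fin.last 2)) A₀ +
        rename (Fin.succAboveEmb (Fin.last 2)) A₁ * X (Fin.last 2)))) :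
    ∀ A₀ A₁ : MvPowerSeries (Fin 2) k, (2 : ℕ∞) < A₀.order → (1 : ℕ∞) < A₁.order → A₁ ≠ 0 →
      CobordantGame.Won k 3 (X (Fin.last 2) ^ 2 + (rename (Fin.succAboveEmb (Fin.last 2)) A₀ +
        rename (Fin.succAboveEmb (Fin.last 2)) A₁ * X (Fin.last 2))) := by
  classical
  obtain ⟨ν, -, hνrad, hνdrop⟩ := stub_planeCountRadical k
  suffices key : ∀ (n : ℕ) (A₀ A₁ : MvPowerSeries (Fin 2) k), ν A₁ = n → (2 : ℕ∞) < A₀.order → (1 : ℕ∞) < A₁.order →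
      A₁ ≠ 0 → CobordantGame.Won k 3 (X (Fin.last 2) ^ 2 + (rename (Fin.succAboveEmb (Fin.last 2)) A₀ +
        rename (Fin.succAboveEmb (Fin.last 2)) A₁ * X (Fin.last 2))) from
    fun A₀ A₁ => key _ A₀ A₁ rfl
  intro n
  induction n using Nat.strong_induction_on with
  | _ n ih =>
  intro A₀ A₁ hn h₀ h₁ hA₁
  by_cases hnc : PlaneGerm.IsNC A₁
  · exact hNC A₀ A₁ h₀ h₁ hA₁ hnc
  refine SepPointStep.won_dp1_of_pointStep hlow A₀ A₁ h₀ h₁ fun c hc B₁ hB₁ => ?_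
  have hconv : ∀ i, (fun _ : Fin 2 => (1 : ℕ)) i = 0 → c i = 0 := fun _ h => absurd h one_ne_zero
  have hne : subst (CobordantChart.chart (fun _ : Fin 2 => 1) c) A₁ ≠ 0 :=
    CobordantChart.subst_chart_ne_zero _ c hconv hA₁
  obtain ⟨a, G, hG, hGnd⟩ := CobordantVertexChart.exists_eq_X_pow_mul_not_dvd hne
  have hc0 : c ≠ 0 := by
    obtain ⟨i, hi⟩ := hc
    intro h
    exact hi (by rw [h]; rfl)
  obtain ⟨i₀, hci₀, hlt⟩ := hνdrop A₁ hA₁ hnc c hc0 a G hG hGnd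
  refine ⟨i₀, hci₀, fun A₀' hA₀' hA₁' => ?_⟩
  -- `a = ord A₁ ≥ 2`
  have ha : (a : ℕ∞) = A₁.order := CobordantChart.eq_weightedOrder_of_factor _ c hconv hA₁ hG hGnd
  have ha2 : 2 ≤ a := by
    have h : (1 : ℕ∞) < (a : ℕ∞) := by rw [ha]; exact h₁
    have h' : 1 < a := by exact_mod_cast h
    omega
  obtain ⟨a', rfl⟩ : ∃ a', a = a' + 2 := ⟨a - 2, by omega⟩
  -- `B₁ = s^{a'} G`
  have hB : B₁ = X 0 ^ a' * G := by
    have h : X 0 ^ 2 * B₁ = X 0 ^ 2 * (X 0 ^ a' * G) := by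
      rw [← hB₁, hG]; ring
    exact mul_left_cancel₀ (pow_ne_zero 2 (FormalCoordChange.X_ne_zero' _)) h
  -- the transported linear coefficient is `s^{a'} · D`, `D = s · G|`
  have hA₁new : TupleGame.slice i₀ (X 0 * B₁) = X 0 ^ a' * (X 0 * TupleGame.slice i₀ G) := by
    rw [hB, show X 0 * (X 0 ^ a' * G) = X 0 ^ a' * (X 0 ^ 1 * G) by ring, MultiplicityLift.slice_X_zero_pow_mul,
      MultiplicityLift.slice_X_zero_pow_mul, pow_one]
  have hsl : TupleGame.slice i₀ G ≠ 0 := by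
    intro h0
    have h := CoeffTransport.slice_subst_chart_ne_zero (n := 1) i₀ c hci₀ hA₁
    rw [hG, MultiplicityLift.slice_X_zero_pow_mul, h0, mul_zero] at h
    exact h rfl
  have hD : X 0 * TupleGame.slice i₀ G ≠ 0 := mul_ne_zero (FormalCoordChange.X_ne_zero' _) hsl
  have hdvd : TupleGame.slice i₀ (X 0 * B₁) ∣ (X 0 * TupleGame.slice i₀ G) ^ (a' + 1) := by
    rw [hA₁new, pow_succ]
    exact mul_dvd_mul (pow_dvd_pow_of_dvd (dvd_mul_right (X 0) _) a') dvd_rfl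
  have hνle := hνrad _ _ hD a' hdvd
  have hnew0 : TupleGame.slice i₀ (X 0 * B₁) ≠ 0 := by
    rw [hA₁new]
    exact mul_ne_zero (pow_ne_zero _ (FormalCoordChange.X_ne_zero' _)) hD
  exact ih (ν (TupleGame.slice i₀ (X 0 * B₁))) (by rw [← hn]; exact lt_of_le_of_lt hνle hlt) A₀' _ rfl hA₀' hA₁' hnew0

end SepNCReduction

open SepNCReduction MvPowerSeries in
/-- S2sM REDUCED TO THE NORMAL-CROSSING-`A₁` CLASS (in the quantifier shape of the proposed stub `stub_charTwoSeparableReductionWon`,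
evidence #56 on stmt-8899).  Over an algebraically closed field of characteristic `2`, given the singular germs in `≤ 2` variables:
if every monic germ `y² + A₁ y + A₀` (`ord A₀ ≥ 3`, `ord A₁ ≥ 2`, `A₁ ≠ 0`) whose linear coefficient has normal-crossing support
(`PlaneGerm.IsNC A₁`) is won, then every monic germ `y² + A₁ y + A₀` with `A₁ ≠ 0` is won.  [OURS · L1 W4.3; the embedded resolution
of the plane curve `A₁ = ∂f/∂y = 0` is thereby removed from S2sM; what remains is the case of a MONOMIAL linear coefficient.] -/
theorem charTwoSeparableReduction_of_ncWon (k : Type) [Field k] [CharP k 2] [IsAlgClosed k]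
    (hlow : ∀ m : ℕ, m < 3 → ∀ g : MvPowerSeries (Fin m) k, CobordantGame.IsSingular k g → CobordantGame.Won k m g)
    (hNC : ∀ A₀ A₁ : MvPowerSeries (Fin 2) k, (2 : ℕ∞) < A₀.order → (1 : ℕ∞) < A₁.order → A₁ ≠ 0 → PlaneGerm.IsNC A₁ →
      CobordantGame.Won k 3 (MvPowerSeries.X (Fin.last 2) ^ 2 + (MvPowerSeries.rename (Fin.succAboveEmb (Fin.last 2)) A₀ +
        MvPowerSeries.rename (Fin.succAboveEmb (Fin.last 2)) A₁ * MvPowerSeries.X (Fin.last 2)))) :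
    ∀ A₀ A₁ : MvPowerSeries (Fin 2) k, (2 : ℕ∞) < A₀.order → (1 : ℕ∞) < A₁.order → A₁ ≠ 0 →
      CobordantGame.Won k 3 (MvPowerSeries.X (Fin.last 2) ^ 2 + (MvPowerSeries.rename (Fin.succAboveEmb (Fin.last 2)) A₀ +
        MvPowerSeries.rename (Fin.succAboveEmb (Fin.last 2)) A₁ * MvPowerSeries.X (Fin.last 2))) :=
  sepWon_of_ncWon (hlow 1 (by norm_num)) hNC

end Summit.ResolutionOfSingularities.ResolutionOfSingularities.Theorems
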